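import Literature.NumberTheory.LFunctions.KeiperPowerSeries
import Mathlib.MeasureTheory.Integral.DominatedConvergence
import Mathlib.Analysis.SpecialFunctions.Integrals.Basic
import HarnessLib

/-!
# RH-FREE discharge of `Keiper1992_eq16`: `Σ_{k≥1} σ_k/k = 0` (the functional equation at `s = 1`)

LINE 1 — LABEL: RH-FREE.  A proof (`Keiper1992_eq16_holds`) of the named fact `Keiper1992_eq16` of the
statements module `KeiperPowerSeries.lean` (cell `rh-crit/dbl`, row W2-Ke92): **[Keiper1992] eq. (16),
p.767** — «the functional equation for `ξ` applied to (13) at `s = 1` yields `Σ_{k≥1} σ_k/k = 0`», i.e.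
`log ξ(0) = log ξ(1)`, `σ_k` Keiper's symmetric power sums over the zeros (tree `zetaZeroPowerSum`).
No definitions, no new named facts.  bears_on: LADDER-RH L-C/L-P (COLUMN 4 LI).  WHAT THIS IS NOT: an
identity among the power sums `σ_k` forced by `ξ(s) = ξ(1−s)`; nothing here bears on the truth of RH.

## Proof

We avoid the logarithm (13) (a branch of `log ξ` on `|s − 1| < 2`) and integrate its derivative
(8)/(14) instead, which the tree has on the whole disc (`Keiper1992_eq8`:
`ξ'(s)/ξ(s) = Σ_{k≥0} σ_{k+1} (1 − s)^k` for `|s − 1| < 2`): termwise integration over `[0, 1]`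
(dominated convergence; the domination `|σ_{k+1}| ≤ M (2/3)^k` comes from the convergence of (8) at
`s = 5/2`) gives `Σ_{k≥0} σ_{k+1}/(k+1) = ∫₀¹ ξ'/ξ`, and `∫₀¹ ξ'/ξ = 0` because `ξ'/ξ(1−x) = −ξ'/ξ(x)`
(tree `logDeriv_riemannXi_one_sub`) — Keiper's «functional equation … at `s = 1`».

## References

* [Keiper1992] J. B. Keiper, *Power series expansions of Riemann's `ξ` function*, Math. Comp. 58
  (1992) 765–773, eqs. (13)–(16) p.767.
-/

noncomputable section

open Filter Topology Finset MeasureTheory intervalIntegral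

namespace Literature.NumberTheory.LFunctions

/-- **RH-FREE.  Discharge of `Keiper1992_eq16`** ([Keiper1992] eq. (16) p.767): `Σ_{k≥1} σ_k/k = 0`
(typed with `k = j + 1`).  Termwise integration of (8) over `[0,1]` and `ξ'/ξ(1−x) = −ξ'/ξ(x)`.
[cite: Keiper1992, eq. (16) p.767] -/
theorem Keiper1992_eq16_holds : Keiper1992_eq16 := by
  -- the terms `F_k(t) = σ_{k+1} (1 − t)^k` and their sum `ξ'/ξ(t)`
  set F : ℕ → ℝ → ℂ := fun k t ↦ zetaZeroPowerSum (k + 1) * (1 - (t : ℂ)) ^ k with hF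
  set g : ℝ → ℂ := fun t ↦ logDeriv riemannXi (t : ℂ) with hg
  -- domination: convergence of (8) at `s = 5/2` bounds `|σ_{k+1}| (3/2)^k`
  have hs0 : ((5 / 2 : ℝ) : ℂ) ∈ Metric.ball (1 : ℂ) 2 := by
    rw [Metric.mem_ball, dist_eq_norm,
      show ((5 / 2 : ℝ) : ℂ) - 1 = ((3 / 2 : ℝ) : ℂ) by push_cast; ring, Complex.norm_real]
    norm_num
  have h0 := (Keiper1992_eq8 hs0).summable.tendsto_atTop_zero.norm
  rw [norm_zero] at h0
  obtain ⟨M, hM⟩ := h0.bddAbove_range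
  have hM' : ∀ k : ℕ, ‖zetaZeroPowerSum (k + 1)‖ * (3 / 2 : ℝ) ^ k ≤ M := by
    intro k
    have h := hM ⟨k, rfl⟩
    have e : ‖zetaZeroPowerSum (k + 1) * (1 - ((5 / 2 : ℝ) : ℂ)) ^ k‖ =
        ‖zetaZeroPowerSum (k + 1)‖ * (3 / 2 : ℝ) ^ k := by
      rw [norm_mul, norm_pow, show (1 : ℂ) - ((5 / 2 : ℝ) : ℂ) = ((-(3 / 2) : ℝ) : ℂ) by push_cast; ring,
        Complex.norm_real]
      norm_num
    simp only at h
    rw [e] at h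
    exact h
  have hM0 : 0 ≤ M := le_trans (by positivity) (hM' 0)
  -- termwise integration over `[0, 1]`
  have hsum : HasSum (fun k ↦ ∫ t in (0 : ℝ)..1, F k t) (∫ t in (0 : ℝ)..1, g t) := by
    refine intervalIntegral.hasSum_integral_of_dominated_convergence
      (fun k _ ↦ M * (2 / 3 : ℝ) ^ k) (fun k ↦ ?_) (fun k ↦ ?_) ?_ ?_ ?_
    · exact (continuous_const.mul ((continuous_const.sub Complex.continuous_ofReal).pow k))
        |>.aestronglyMeasurable
    · refine Eventually.of_forall fun t ht ↦ ?_
      have ht' : t ∈ Set.Ioc (0 : ℝ) 1 := by simpa using ht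
      have h1t : ‖(1 : ℂ) - (t : ℂ)‖ ≤ 1 := by
        rw [show (1 : ℂ) - (t : ℂ) = ((1 - t : ℝ) : ℂ) by push_cast; ring, Complex.norm_real,
          Real.norm_eq_abs, abs_le]
        constructor <;> linarith [ht'.1, ht'.2]
      have hpow : ‖(1 : ℂ) - (t : ℂ)‖ ^ k ≤ 1 := pow_le_one₀ (norm_nonneg _) h1t
      have h23 : (0 : ℝ) < (2 / 3 : ℝ) ^ k := by positivity
      calc ‖F k t‖ = ‖zetaZeroPowerSum (k + 1)‖ * ‖(1 : ℂ) - (t : ℂ)‖ ^ k := by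
            rw [hF]; simp only [norm_mul, norm_pow]
        _ ≤ ‖zetaZeroPowerSum (k + 1)‖ * 1 := by gcongr
        _ = ‖zetaZeroPowerSum (k + 1)‖ * (3 / 2 : ℝ) ^ k * (2 / 3 : ℝ) ^ k := by
            rw [mul_assoc, ← mul_pow]; norm_num
        _ ≤ M * (2 / 3 : ℝ) ^ k := by gcongr; exact hM' k
    · exact Eventually.of_forall fun t _ ↦
        (summable_geometric_of_lt_one (by norm_num) (by norm_num)).mul_left M
    · exact intervalIntegrable_const
    · refine Eventually.of_forall fun t ht ↦ ?_
      have ht' : t ∈ Set.Ioc (0 : ℝ) 1 := by simpa using ht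
      have htball : (t : ℂ) ∈ Metric.ball (1 : ℂ) 2 := by
        rw [Metric.mem_ball, dist_eq_norm, show (t : ℂ) - 1 = ((t - 1 : ℝ) : ℂ) by push_cast; ring,
          Complex.norm_real, Real.norm_eq_abs, abs_lt]
        constructor <;> linarith [ht'.1, ht'.2]
      exact Keiper1992_eq8 htball
  -- `∫₀¹ ξ'/ξ = 0` by the functional equation
  have hint : ∫ t in (0 : ℝ)..1, g t = 0 := by
    have h1 : ∫ t in (0 : ℝ)..1, g (1 - t) = ∫ t in (0 : ℝ)..1, g t := by
      rw [intervalIntegral.integral_comp_sub_left g 1]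
      norm_num
    have h2 : (fun t ↦ g (1 - t)) = fun t ↦ -g t := by
      funext t
      simp only [hg]
      push_cast
      exact logDeriv_riemannXi_one_sub _
    rw [h2, intervalIntegral.integral_neg] at h1
    have h3 : (2 : ℂ) * ∫ t in (0 : ℝ)..1, g t = 0 := by linear_combination -h1
    simpa using h3
  -- the termwise integrals: `∫₀¹ σ_{k+1} (1−t)^k dt = σ_{k+1}/(k+1)`
  have hterm : ∀ k : ℕ, ∫ t in (0 : ℝ)..1, F k t = zetaZeroPowerSum (k + 1) / (k + 1) := by
    intro k
    have hreal : ∫ t in (0 : ℝ)..1, (1 - t) ^ k = 1 / ((k : ℝ) + 1) := by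
      rw [intervalIntegral.integral_comp_sub_left (fun x ↦ x ^ k) 1]
      norm_num [integral_pow]
    have hF' : (fun t : ℝ ↦ F k t) = fun t ↦ zetaZeroPowerSum (k + 1) * (((1 - t) ^ k : ℝ) : ℂ) := by
      funext t; simp only [hF]; push_cast; ring
    rw [hF', intervalIntegral.integral_const_mul, intervalIntegral.integral_ofReal, hreal]
    push_cast
    ring
  rw [hint] at hsum
  simp_rw [hterm] at hsum
  exact hsum

end Literature.NumberTheory.LFunctions
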